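import Literature.Probability.RandomPlanarGeometry.HexSAWSurfaceWallRateExponentPinch
import Literature.Probability.RandomPlanarGeometry.HexSAWSurfaceWallDensity
import HarnessLib

/-!
# «DENSITY-PINCH» — the one-sided surface densities of zig-zag wall bridges are pinched by the renewal mean:
# `1/(2 m(y)) ≤ ρ⁺(log y)`, `ρ⁻(log y) ≤ (1 + 1/m(y))/4`, everywhere on `y > μ⁴`; the DEFICIT WINDOW
# `(m(y) − 1)/(4 m(y)) ≤ ½ − ρ(y) ≤ (m(y) − 1)/(2 m(y))` at every point of differentiability (a.e.), and the explicit
# deficit `1/(20 y² + 8) ≤ ½ − ρ^±(log y)`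

THE STATEMENT.  `β(y) = wallRate y` is the growth rate of zig-zag (BBdGDCG) wall bridges of the hexagonal lattice at surface
fugacity `y`, `κ(t) = log β(eᵗ)` its free energy in the variable `t = log y` (`wallFreeEnergy`, convex, tree file
`HexSAWSurfaceWallDensity`), `ρ⁺(t) = d⁺κ/dt`, `ρ⁻(t) = d⁻κ/dt` the one-sided DENSITIES of adsorbed (wall) vertices
(`wallRightDensity`, `wallLeftDensity`; they exist at every `t`, `0 ≤ ρ⁻ ≤ ρ⁺ ≤ ½`, and both equal `y β'(y)/β(y)` wherever `β`
is differentiable, which is almost everywhere), and `m(y) = pwbMean y ≥ 1` the mean piece length of Kesten's prime-wall-bridge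
renewal law (`HexSAWSurfaceWallRenewal`).  On the adsorbed regime `y > μ⁴` we prove, AT EVERY `t` with `eᵗ > μ⁴` and with no
differentiability or continuity hypothesis:

* `1/(2 m(eᵗ)) ≤ ρ⁺(t)` (`inv_two_mul_pwbMean_le_wallRightDensity`) and `ρ⁻(t) ≤ (1 + 1/m(eᵗ))/4`
  (`wallLeftDensity_le_quarter_mul`); interlaced: `1/(2 m(eᵗ)) ≤ ρ⁺(t) ≤ ρ⁻(t') ≤ (1 + 1/m(e^{t'}))/4` for `t < t'`
  (`wallDensity_two_point_pinch`);
* the positive density of visits in the adsorbed regime: `0 < ρ⁻(t) ≤ ρ⁺(t)` (`wallLeftDensity_pos`, `wallRightDensity_pos`);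
* the EXPLICIT DEFICIT `ρ⁺(t) ≤ ½ − 1/(20 e^{2t} + 8)` (`wallRightDensity_le_half_sub`), i.e. in density at most one vertex in
  two is adsorbed MINUS an explicit `1/(20y² + 8)` — the quantitative companion, valid on all of `y > μ⁴`, of the tree's strict
  `wallRightDensity_lt_half` and of its saturation bound `½ − 36e/√y ≤ ρ⁻` (`half_sub_le_wallLeftDensity`, `y ≥ (72e)²`);
* the DEFICIT WINDOW in terms of the renewal excess `m − 1`: `½ − ρ⁺(t) ≤ (m(eᵗ) − 1)/(2 m(eᵗ))` and
  `(m(eᵗ) − 1)/(4 m(eᵗ)) ≤ ½ − ρ⁻(t)` (`half_sub_wallRightDensity_le`, `le_half_sub_wallLeftDensity`), so that at every point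
  of differentiability `y > μ⁴` of `β` (almost every `y`) the density deficit is comparable to the renewal excess within a factor
  two: `(m(y) − 1)/(4 m(y)) ≤ ½ − y β'(y)/β(y) ≤ (m(y) − 1)/(2 m(y))` (`wallDensity_deficit_pinch_of_differentiableAt`,
  `ae_wallDensity_deficit_pinch`), together with `1/(2 m(y)) ≤ y β'(y)/β(y) ≤ (1 + 1/m(y))/4`
  (`wallDensity_pinch_of_differentiableAt`), `0 < β'(y)` (`deriv_wallRate_pos`) and the explicit sharpening
  `y β'(y) ≤ β(y) (½ − 1/(20 y² + 8))` (`mul_deriv_wallRate_le_half_sub`) of the tree's `mul_deriv_wallRate_le_half`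
  (`y β'(y) ≤ β(y)/2`, valid for all `y > 0`).

MECHANISM.  The two chord inequalities of the lane — the LOWER chord `log(y'/y)/m(y) ≤ log(β(y')²/β(y)²)` with the renewal mean
taken at the LOWER fugacity («STRICT-RATE», `log_sq_wallRate_div_two_sided`) and the UPPER chord
`log(β(y')²/β(y)²) ≤ (½ + 1/(2 m(y'))) log(y'/y)` with the mean taken at the UPPER fugacity («EXPONENT-PINCH»,
`log_sq_wallRate_div_le_half_mul_log`) — say, in the variable `t = log y`, that every chord of the convex function `κ` over
`[t, t']` has slope in `[1/(2 m(eᵗ)), (1 + 1/m(e^{t'}))/4]` (`inv_two_mul_pwbMean_le_slope_wallFreeEnergy`,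
`slope_wallFreeEnergy_le_quarter_mul`).  The right derivative `ρ⁺(t)` is the limit of the slopes of chords with FIXED LEFT end `t`
(`hasDerivWithinAt_wallRightDensity`), whose lower bound `1/(2 m(eᵗ))` does not move; the left derivative `ρ⁻(t')` is the limit
of slopes of chords with FIXED RIGHT end `t'`, whose upper bound `(1 + 1/m(e^{t'}))/4` does not move.  So neither limit needs the
continuity of `m`, and convexity (`ρ⁻ ≤ ρ⁺`, `ρ⁺(t) ≤ ρ⁻(t')` for `t < t'`, tree) closes the window; at a point of
differentiability `ρ⁻ = ρ⁺ = y β'/β` (tree `wallRightDensity_eq_of_differentiableAt`).  The explicit deficit uses the lane's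
floor `(5y² + 1) m(y) ≥ 5y² + 2` («EXPONENT-PINCH», `mul_pwbMean_ge`) and, for `ρ⁺`, the continuity of `t' ↦ 1/(20 e^{2t'} + 8)`.

HONEST LABEL.  LANE COROLLARY (CLASS D on «EXPONENT-PINCH» → «STRICT-RATE») joined to the tree's convex-analysis frame
`HexSAWSurfaceWallDensity`; every step is elementary real analysis on top of the two chord inequalities.  What is new in the
tree: lower AND upper bounds on the one-sided densities of adsorbed vertices at EVERY fugacity `y > μ⁴` in terms of the renewal
mean at the SAME fugacity, the positivity of the density of visits on `y > μ⁴` (the adsorbed-phase half of the classical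
order-parameter picture, here only above `μ⁴`, not down to the critical fugacity `1 + √2`), and an explicit density deficit
`1/(20y² + 8)` on the whole regime.  Not claimed: anything at or below `y = μ⁴`, continuity of `m`, differentiability of `β`,
or the true order of the deficit.

[cite: BeatonBousquetMelouDeGierDuminilCopinGuttmann2014, Section 3.1, Proposition 5 (arXiv v5 p. 9: `μ(y)` "is a
log-convex, non-decreasing function of log y … almost everywhere differentiable") and p. 10 ("the mean density of vertices in
the surface … tends to y ∂ log μ(y)/∂y … is positive for y > y_c")]
[cite: HammersleyTorrieWhittington1982, Section 2 (free energy of self-avoiding walks interacting with a surface: existence,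
convexity in the log-fugacity, density of visits as its derivative)]
[cite: JansevanRensburgWhittington2013, Section 3.1, eq. (3.3)-(3.4) (arXiv v4 p. 6: one-sided energy densities
`𝓔_±(a) = a d^±κ/da` of a convex free energy, `𝓔_-(a) ≤ 𝓔_+(a)`, monotone)]
[cite: JansevanRensburg2000, Section 3.3, eq. (3.17) (density of visits = derivative of the free energy) and Section 5.4,
Theorem 5.55 (positive density of visits in the adsorbed phase)]
[cite: Kesten1963SAW, Section 4 (renewal structure of bridges: prime/irreducible bridge decomposition)]
[cite: MadrasSlade1993, Section 4.2, (4.2.4) (p. 91) and Theorem 4.2.2 (pp. 91-92) (renewal equation for bridges and the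
mean of the irreducible-bridge law)]
[cite: Hollander2009, Section 7.1, Theorem 7.3 and (7.26) (free energy of a pinned polymer through the renewal mean;
derivative = density of returns)]
-/

namespace Literature.Probability.RandomPlanarGeometry.SAW.HexBW.Wall

open Finset Filter Function
open Literature.Probability.LatticeModels
open _root_.Topology

variable {y : ℝ} {t t' : ℝ}

/-! ### §1. The two chords of the lane in the variable `t = log y` -/

/-- `log(e^{t'}/eᵗ) = t' − t` (the variable `t = log y`). [cite: BeatonBousquetMelouDeGierDuminilCopinGuttmann2014, Section 3.1, Proposition 5 (arXiv v5 p. 9)] -/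
private theorem log_exp_div_exp_dp (t t' : ℝ) : Real.log (Real.exp t' / Real.exp t) = t' - t := by
  rw [Real.log_div (Real.exp_pos _).ne' (Real.exp_pos _).ne', Real.log_exp, Real.log_exp]

/-- `log(β(e^{t'})²/β(eᵗ)²) = 2 (κ(t') − κ(t))`. [cite: BeatonBousquetMelouDeGierDuminilCopinGuttmann2014, Section 3.1, Proposition 5 (arXiv v5 p. 9)] -/
private theorem log_sq_div_sq_dp (t t' : ℝ) :
    Real.log (wallRate (Real.exp t') ^ 2 / wallRate (Real.exp t) ^ 2) =
      2 * (wallFreeEnergy t' - wallFreeEnergy t) := by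
  rw [Real.log_div (pow_pos (wallRate_pos _) 2).ne' (pow_pos (wallRate_pos _) 2).ne', Real.log_pow, Real.log_pow,
    wallFreeEnergy_apply, wallFreeEnergy_apply]
  push_cast
  ring

/-- `μ⁴ < eᵗ → log μ⁴ < t`, the regime in the variable `t`. [cite: BeatonBousquetMelouDeGierDuminilCopinGuttmann2014, Section 3.1, Proposition 5 (arXiv v5 p. 9)] -/
private theorem log_mu_four_lt_dp (ht : hexConnectiveConstant ^ 4 < Real.exp t) :
    Real.log (hexConnectiveConstant ^ 4) < t :=
  (Real.log_lt_iff_lt_exp (pow_pos hexConnectiveConstant_pos 4)).2 ht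

/-- `log μ⁴ < t → μ⁴ < eᵗ`. [cite: BeatonBousquetMelouDeGierDuminilCopinGuttmann2014, Section 3.1, Proposition 5 (arXiv v5 p. 9)] -/
private theorem mu_four_lt_exp_dp (ht : Real.log (hexConnectiveConstant ^ 4) < t) :
    hexConnectiveConstant ^ 4 < Real.exp t :=
  (Real.log_lt_iff_lt_exp (pow_pos hexConnectiveConstant_pos 4)).1 ht

/-- **LOWER CHORD: `1/(2 m(eᵗ)) ≤ (κ(t') − κ(t))/(t' − t)` for `t < t'`, `eᵗ > μ⁴`** — «STRICT-RATE»'s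
`log(y'/y)/m(y) ≤ log(β(y')²/β(y)²)` with the renewal mean at the LOWER fugacity, in the variable `t = log y`.
[cite: BeatonBousquetMelouDeGierDuminilCopinGuttmann2014, Section 3.1, Proposition 5 (arXiv v5 p. 9: "log-convex,
non-decreasing function of log y"); MadrasSlade1993, Section 4.2, Theorem 4.2.2 (pp. 91-92); Kesten1963SAW, Section 4] -/
theorem inv_two_mul_pwbMean_le_slope_wallFreeEnergy (ht : hexConnectiveConstant ^ 4 < Real.exp t) (h : t < t') :
    1 / (2 * pwbMean (Real.exp t)) ≤ slope wallFreeEnergy t t' := by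
  have hle : Real.exp t ≤ Real.exp t' := Real.exp_le_exp.2 h.le
  have h1 := (log_sq_wallRate_div_two_sided ht hle).1
  rw [log_exp_div_exp_dp, log_sq_div_sq_dp] at h1
  have hm : 0 < pwbMean (Real.exp t) := pwbMean_pos ht
  have hpos : 0 < t' - t := sub_pos.2 h
  rw [slope_def_field, le_div_iff₀ hpos]
  rw [div_le_iff₀ hm] at h1
  rw [div_mul_eq_mul_div, one_mul, div_le_iff₀ (by positivity)]
  nlinarith

/-- **UPPER CHORD: `(κ(t') − κ(t))/(t' − t) ≤ (1 + 1/m(e^{t'}))/4` for `t < t'`, `eᵗ > μ⁴`** — «EXPONENT-PINCH»'s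
`log(β(y')²/β(y)²) ≤ (½ + 1/(2 m(y'))) log(y'/y)` with the renewal mean at the UPPER fugacity, in the variable `t = log y`.
[cite: BeatonBousquetMelouDeGierDuminilCopinGuttmann2014, Section 3.1, Proposition 5 (arXiv v5 p. 9); MadrasSlade1993,
Section 4.2, (4.2.4) (p. 91); JansevanRensburg2000, Section 3.3, eq. (3.17)] -/
theorem slope_wallFreeEnergy_le_quarter_mul (ht : hexConnectiveConstant ^ 4 < Real.exp t) (h : t < t') :
    slope wallFreeEnergy t t' ≤ (1 + 1 / pwbMean (Real.exp t')) / 4 := by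
  have hle : Real.exp t ≤ Real.exp t' := Real.exp_le_exp.2 h.le
  have h2 := log_sq_wallRate_div_le_half_mul_log ht hle
  rw [log_exp_div_exp_dp, log_sq_div_sq_dp] at h2
  have hm : 0 < pwbMean (Real.exp t') := pwbMean_pos (ht.trans_le hle)
  have hpos : 0 < t' - t := sub_pos.2 h
  rw [slope_def_field, div_le_iff₀ hpos]
  have e : (1 / 2 + 1 / (2 * pwbMean (Real.exp t'))) * (t' - t) =
      2 * ((1 + 1 / pwbMean (Real.exp t')) / 4 * (t' - t)) := by
    field_simp
    ring
  rw [e] at h2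
  linarith

/-- **EXPLICIT UPPER CHORD: `(κ(t') − κ(t))/(t' − t) ≤ ½ − 1/(20 e^{2t'} + 8)` for `t < t'`, `eᵗ > μ⁴`.**
[cite: BeatonBousquetMelouDeGierDuminilCopinGuttmann2014, Section 3.1, Proposition 5 (arXiv v5 p. 9); MadrasSlade1993,
Section 4.2, (4.2.4) (p. 91)] -/
theorem slope_wallFreeEnergy_le_half_sub (ht : hexConnectiveConstant ^ 4 < Real.exp t) (h : t < t') :
    slope wallFreeEnergy t t' ≤ 1 / 2 - 1 / (20 * Real.exp t' ^ 2 + 8) := by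
  have hle : Real.exp t ≤ Real.exp t' := Real.exp_le_exp.2 h.le
  have h3 := log_sq_wallRate_div_le_explicit ht hle
  rw [log_exp_div_exp_dp, log_sq_div_sq_dp] at h3
  have hpos : 0 < t' - t := sub_pos.2 h
  rw [slope_def_field, div_le_iff₀ hpos]
  have hq : (0 : ℝ) < 10 * Real.exp t' ^ 2 + 4 := by positivity
  have e : (1 - 1 / (10 * Real.exp t' ^ 2 + 4)) * (t' - t) =
      2 * ((1 / 2 - 1 / (20 * Real.exp t' ^ 2 + 8)) * (t' - t)) := by
    field_simp
    ring
  rw [e] at h3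
  linarith

/-! ### §2. Everywhere bounds on the one-sided densities (no differentiability, no continuity of `m`) -/

/-- `ρ⁺(t)` is the limit of the slopes of chords with fixed LEFT end `t`. [cite: JansevanRensburgWhittington2013, Section 3.1, eq. (3.4) (arXiv v4 p. 6)] -/
private theorem tendsto_slope_right_dp (t : ℝ) :
    Tendsto (slope wallFreeEnergy t) (𝓝[>] t) (𝓝 (wallRightDensity t)) :=
  (hasDerivWithinAt_iff_tendsto_slope' (fun h : t ∈ Set.Ioi t => lt_irrefl t h)).1
    (hasDerivWithinAt_wallRightDensity t)

/-- `ρ⁻(t)` is the limit of the slopes of chords with fixed RIGHT end `t`. [cite: JansevanRensburgWhittington2013, Section 3.1, eq. (3.4) (arXiv v4 p. 6)] -/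
private theorem tendsto_slope_left_dp (t : ℝ) :
    Tendsto (slope wallFreeEnergy t) (𝓝[<] t) (𝓝 (wallLeftDensity t)) :=
  (hasDerivWithinAt_iff_tendsto_slope' (fun h : t ∈ Set.Iio t => lt_irrefl t h)).1
    (hasDerivWithinAt_wallLeftDensity t)

/-- **★ `1/(2 m(eᵗ)) ≤ ρ⁺(t)` at EVERY `t` with `eᵗ > μ⁴`**: the right density of adsorbed vertices of zig-zag wall bridges is
at least the reciprocal of twice the renewal mean at the same fugacity — the density of renewal points `1/m(y)` (one forced
wall vertex per prime piece, two letters `t`-growth per unit of `log y²`).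
[cite: BeatonBousquetMelouDeGierDuminilCopinGuttmann2014, Section 3.1, Proposition 5 (arXiv v5 p. 9) and p. 10 ("the mean
density of vertices in the surface … tends to y ∂ log μ(y)/∂y"); JansevanRensburgWhittington2013, Section 3.1, eq. (3.4)
(arXiv v4 p. 6); Hollander2009, Section 7.1, Theorem 7.3; MadrasSlade1993, Section 4.2, Theorem 4.2.2 (pp. 91-92)] -/
theorem inv_two_mul_pwbMean_le_wallRightDensity (ht : hexConnectiveConstant ^ 4 < Real.exp t) :
    1 / (2 * pwbMean (Real.exp t)) ≤ wallRightDensity t :=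
  ge_of_tendsto (tendsto_slope_right_dp t)
    (eventually_nhdsWithin_of_forall fun _ ht' => inv_two_mul_pwbMean_le_slope_wallFreeEnergy ht ht')

/-- **★ `ρ⁻(t) ≤ (1 + 1/m(eᵗ))/4` at EVERY `t` with `eᵗ > μ⁴`**: the left density of adsorbed vertices is at most the average
of the maximal density `½` and the renewal density `1/(2 m)` at the same fugacity.
[cite: BeatonBousquetMelouDeGierDuminilCopinGuttmann2014, Section 3.1, Proposition 5 (arXiv v5 p. 9) and p. 10;
JansevanRensburgWhittington2013, Section 3.1, eq. (3.4) (arXiv v4 p. 6); JansevanRensburg2000, Section 3.3, eq. (3.17);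
MadrasSlade1993, Section 4.2, (4.2.4) (p. 91)] -/
theorem wallLeftDensity_le_quarter_mul (ht : hexConnectiveConstant ^ 4 < Real.exp t) :
    wallLeftDensity t ≤ (1 + 1 / pwbMean (Real.exp t)) / 4 := by
  refine le_of_tendsto (tendsto_slope_left_dp t) ?_
  filter_upwards [Ioo_mem_nhdsLT (log_mu_four_lt_dp ht)] with t' ht'
  rw [slope_comm]
  exact slope_wallFreeEnergy_le_quarter_mul (mu_four_lt_exp_dp ht'.1) ht'.2

/-- **`ρ⁻(t) ≤ ½ − 1/(20 e^{2t} + 8)` at every `t` with `eᵗ > μ⁴`** (explicit form of `wallLeftDensity_le_quarter_mul`, through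
«EXPONENT-PINCH»'s floor `(5y² + 1) m(y) ≥ 5y² + 2`).
[cite: BeatonBousquetMelouDeGierDuminilCopinGuttmann2014, Section 3.1, Proposition 5 (arXiv v5 p. 9); MadrasSlade1993,
Section 4.2, (4.2.4) (p. 91)] -/
theorem wallLeftDensity_le_half_sub (ht : hexConnectiveConstant ^ 4 < Real.exp t) :
    wallLeftDensity t ≤ 1 / 2 - 1 / (20 * Real.exp t ^ 2 + 8) := by
  refine le_of_tendsto (tendsto_slope_left_dp t) ?_
  filter_upwards [Ioo_mem_nhdsLT (log_mu_four_lt_dp ht)] with t' ht'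
  rw [slope_comm]
  exact slope_wallFreeEnergy_le_half_sub (mu_four_lt_exp_dp ht'.1) ht'.2

/-- **`ρ⁺(t) ≤ (1 + 1/m(e^{t'}))/4` for every `t < t'` with `eᵗ > μ⁴`** (right density below the upper chord bound at any
larger fugacity). [cite: BeatonBousquetMelouDeGierDuminilCopinGuttmann2014, Section 3.1, Proposition 5 (arXiv v5 p. 9:
"log-convex"); JansevanRensburgWhittington2013, Section 3.1, eq. (3.4) (arXiv v4 p. 6)] -/
theorem wallRightDensity_le_quarter_mul_of_lt (ht : hexConnectiveConstant ^ 4 < Real.exp t) (h : t < t') :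
    wallRightDensity t ≤ (1 + 1 / pwbMean (Real.exp t')) / 4 :=
  (wallRightDensity_le_slope h).trans (slope_wallFreeEnergy_le_quarter_mul ht h)

/-- **★ `ρ⁺(t) ≤ ½ − 1/(20 e^{2t} + 8)` at EVERY `t` with `eᵗ > μ⁴`**: in density, at most one vertex in two of a long zig-zag
wall bridge is adsorbed, minus an explicit `1/(20 y² + 8)` — the quantitative companion on the whole regime `y > μ⁴` of the
tree's strict `wallRightDensity_lt_half`. (The bound at `t' > t` is `wallRightDensity_le_slope` + `slope_wallFreeEnergy_le_half_sub`;
let `t' ↓ t` along the continuous bound.)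
[cite: BeatonBousquetMelouDeGierDuminilCopinGuttmann2014, Section 3.1, Proposition 5 (arXiv v5 p. 9) and p. 10 ("μ(y) ∼ √y");
MadrasSlade1993, Section 4.2, (4.2.4) (p. 91)] -/
theorem wallRightDensity_le_half_sub (ht : hexConnectiveConstant ^ 4 < Real.exp t) :
    wallRightDensity t ≤ 1 / 2 - 1 / (20 * Real.exp t ^ 2 + 8) := by
  have hc : Continuous fun s : ℝ => 1 / 2 - 1 / (20 * Real.exp s ^ 2 + 8) := by
    refine continuous_const.sub (continuous_const.div (by fun_prop) fun s => ?_)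
    positivity
  have hT : Tendsto (fun s : ℝ => 1 / 2 - 1 / (20 * Real.exp s ^ 2 + 8)) (𝓝[>] t)
      (𝓝 (1 / 2 - 1 / (20 * Real.exp t ^ 2 + 8))) :=
    (hc.tendsto t).mono_left nhdsWithin_le_nhds
  refine ge_of_tendsto hT ?_
  exact eventually_nhdsWithin_of_forall fun t' ht' =>
    (wallRightDensity_le_slope ht').trans (slope_wallFreeEnergy_le_half_sub ht ht')

/-- **TWO-POINT PINCH: `1/(2 m(eᵗ)) ≤ ρ⁺(t) ≤ ρ⁻(t') ≤ (1 + 1/m(e^{t'}))/4` for `t < t'`, `eᵗ > μ⁴`** — the one-sided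
densities interlace (convexity, tree `wallRightDensity_le_wallLeftDensity_of_lt`) inside the renewal window.
[cite: BeatonBousquetMelouDeGierDuminilCopinGuttmann2014, Section 3.1, Proposition 5 (arXiv v5 p. 9);
JansevanRensburgWhittington2013, Section 3.1, eq. (3.4) (arXiv v4 p. 6: «𝓔_-(a) ≤ 𝓔_+(a)», monotone);
MadrasSlade1993, Section 4.2, Theorem 4.2.2 (pp. 91-92)] -/
theorem wallDensity_two_point_pinch (ht : hexConnectiveConstant ^ 4 < Real.exp t) (h : t < t') :
    1 / (2 * pwbMean (Real.exp t)) ≤ wallRightDensity t ∧ wallRightDensity t ≤ wallLeftDensity t' ∧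
      wallLeftDensity t' ≤ (1 + 1 / pwbMean (Real.exp t')) / 4 :=
  ⟨inv_two_mul_pwbMean_le_wallRightDensity ht, wallRightDensity_le_wallLeftDensity_of_lt h,
    wallLeftDensity_le_quarter_mul (ht.trans (Real.exp_lt_exp.2 h))⟩

/-- **`0 < ρ⁺(t)` for `eᵗ > μ⁴`**: a positive (right) density of adsorbed vertices in the regime `y > μ⁴`.
[cite: BeatonBousquetMelouDeGierDuminilCopinGuttmann2014, Section 3.1 (arXiv v5 p. 10: the mean density of vertices in the
surface "is positive for y > y_c"); JansevanRensburg2000, Section 5.4, Theorem 5.55; HammersleyTorrieWhittington1982, Section 2] -/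
theorem wallRightDensity_pos (ht : hexConnectiveConstant ^ 4 < Real.exp t) : 0 < wallRightDensity t :=
  lt_of_lt_of_le (by have := pwbMean_pos ht; positivity) (inv_two_mul_pwbMean_le_wallRightDensity ht)

/-- **`0 < ρ⁻(t)` for `eᵗ > μ⁴`**: a positive LEFT density of adsorbed vertices too (through a point `t₀ ∈ (log μ⁴, t)`:
`ρ⁻(t) ≥ ρ⁺(t₀) > 0`). [cite: BeatonBousquetMelouDeGierDuminilCopinGuttmann2014, Section 3.1 (arXiv v5 p. 10: "is positive
for y > y_c"); JansevanRensburg2000, Section 5.4, Theorem 5.55; JansevanRensburgWhittington2013, Section 3.1, eq. (3.4)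
(arXiv v4 p. 6)] -/
theorem wallLeftDensity_pos (ht : hexConnectiveConstant ^ 4 < Real.exp t) : 0 < wallLeftDensity t := by
  obtain ⟨t₀, h₀, h₁⟩ := exists_between (log_mu_four_lt_dp ht)
  exact (wallRightDensity_pos (mu_four_lt_exp_dp h₀)).trans_le (wallRightDensity_le_wallLeftDensity_of_lt h₁)

/-! ### §3. The deficit window `½ − ρ` against the renewal excess `m − 1` -/

/-- **`½ − ρ⁺(t) ≤ (m(eᵗ) − 1)/(2 m(eᵗ))` for `eᵗ > μ⁴`**: the density deficit of the right density is at most half the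
relative renewal excess. [cite: BeatonBousquetMelouDeGierDuminilCopinGuttmann2014, Section 3.1, Proposition 5 (arXiv v5 p. 9)
and p. 10; Hollander2009, Section 7.1, Theorem 7.3 and (7.26); MadrasSlade1993, Section 4.2, Theorem 4.2.2 (pp. 91-92)] -/
theorem half_sub_wallRightDensity_le (ht : hexConnectiveConstant ^ 4 < Real.exp t) :
    1 / 2 - wallRightDensity t ≤ (pwbMean (Real.exp t) - 1) / (2 * pwbMean (Real.exp t)) := by
  have hm : 0 < pwbMean (Real.exp t) := pwbMean_pos ht
  have h := inv_two_mul_pwbMean_le_wallRightDensity ht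
  have e : (pwbMean (Real.exp t) - 1) / (2 * pwbMean (Real.exp t)) = 1 / 2 - 1 / (2 * pwbMean (Real.exp t)) := by
    field_simp
  rw [e]
  linarith

/-- **`(m(eᵗ) − 1)/(4 m(eᵗ)) ≤ ½ − ρ⁻(t)` for `eᵗ > μ⁴`**: the density deficit of the left density is at least a quarter of
the relative renewal excess. [cite: BeatonBousquetMelouDeGierDuminilCopinGuttmann2014, Section 3.1, Proposition 5 (arXiv v5
p. 9) and p. 10; JansevanRensburg2000, Section 3.3, eq. (3.17); MadrasSlade1993, Section 4.2, (4.2.4) (p. 91)] -/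
theorem le_half_sub_wallLeftDensity (ht : hexConnectiveConstant ^ 4 < Real.exp t) :
    (pwbMean (Real.exp t) - 1) / (4 * pwbMean (Real.exp t)) ≤ 1 / 2 - wallLeftDensity t := by
  have hm : 0 < pwbMean (Real.exp t) := pwbMean_pos ht
  have h := wallLeftDensity_le_quarter_mul ht
  have e : (pwbMean (Real.exp t) - 1) / (4 * pwbMean (Real.exp t)) =
      1 / 2 - (1 + 1 / pwbMean (Real.exp t)) / 4 := by
    field_simp
    ring
  rw [e]
  linarith

/-- **EXPLICIT DEFICIT `1/(20 e^{2t} + 8) ≤ ½ − ρ⁺(t) ≤ ½ − ρ⁻(t)` for `eᵗ > μ⁴`** — to be read next to the tree's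
saturation bound `½ − ρ⁻(t) ≤ 36e·e^{−t/2}` (`half_sub_le_wallLeftDensity`, `t ≥ 2 + 2 log 72`).
[cite: BeatonBousquetMelouDeGierDuminilCopinGuttmann2014, Section 3.1, Proposition 5 (arXiv v5 p. 9) and p. 10 ("μ(y) ∼ √y");
MadrasSlade1993, Section 4.2, (4.2.4) (p. 91)] -/
theorem explicit_le_half_sub_wallDensity (ht : hexConnectiveConstant ^ 4 < Real.exp t) :
    1 / (20 * Real.exp t ^ 2 + 8) ≤ 1 / 2 - wallRightDensity t ∧
      1 / 2 - wallRightDensity t ≤ 1 / 2 - wallLeftDensity t :=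
  ⟨by linarith [wallRightDensity_le_half_sub ht], by linarith [wallLeftDensity_le_wallRightDensity t]⟩

/-! ### §4. At points of differentiability of `β` (almost every `y`): the pinch of `y β'(y)/β(y)` -/

/-- `e^{log y} = y` on the regime. [cite: BeatonBousquetMelouDeGierDuminilCopinGuttmann2014, Section 3.1, Proposition 5 (arXiv v5 p. 9)] -/
private theorem exp_log_dp (hy : hexConnectiveConstant ^ 4 < y) : Real.exp (Real.log y) = y :=
  Real.exp_log ((pow_pos hexConnectiveConstant_pos 4).trans hy)

/-- `μ⁴ < e^{log y}` on the regime. [cite: BeatonBousquetMelouDeGierDuminilCopinGuttmann2014, Section 3.1, Proposition 5 (arXiv v5 p. 9)] -/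
private theorem mu_four_lt_exp_log_dp (hy : hexConnectiveConstant ^ 4 < y) :
    hexConnectiveConstant ^ 4 < Real.exp (Real.log y) := by
  rwa [exp_log_dp hy]

/-- At a point of differentiability `y > μ⁴` of `β`: `ρ⁺(log y) = ρ⁻(log y) = y β'(y)/β(y)` (tree, restated at `t = log y`).
[cite: BeatonBousquetMelouDeGierDuminilCopinGuttmann2014, Section 3.1, Proposition 5 (arXiv v5 p. 9: "almost everywhere differentiable")] -/
private theorem densities_eq_dp (hy : hexConnectiveConstant ^ 4 < y) (hd : DifferentiableAt ℝ wallRate y) :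
    wallRightDensity (Real.log y) = y * deriv wallRate y / wallRate y ∧
      wallLeftDensity (Real.log y) = y * deriv wallRate y / wallRate y := by
  have hd' : DifferentiableAt ℝ wallRate (Real.exp (Real.log y)) := by rwa [exp_log_dp hy]
  have h1 := wallRightDensity_eq_of_differentiableAt hd'
  have h2 := wallLeftDensity_eq_of_differentiableAt hd'
  rw [exp_log_dp hy] at h1 h2
  exact ⟨h1, h2⟩

/-- **★★ DENSITY PINCH at a point of differentiability: for `y > μ⁴` with `β` differentiable at `y`,
`1/(2 m(y)) ≤ y β'(y)/β(y) ≤ (1 + 1/m(y))/4`** — the density of adsorbed vertices lies between the renewal density `1/(2m)`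
and its average with the maximal density `½`, both at the SAME fugacity.
[cite: BeatonBousquetMelouDeGierDuminilCopinGuttmann2014, Section 3.1, Proposition 5 (arXiv v5 p. 9: "almost everywhere
differentiable") and p. 10 ("tends to y ∂ log μ(y)/∂y"); JansevanRensburgWhittington2013, Section 3.1, eq. (3.3) (arXiv v4
p. 6); JansevanRensburg2000, Section 3.3, eq. (3.17); Hollander2009, Section 7.1, Theorem 7.3 and (7.26); MadrasSlade1993,
Section 4.2, (4.2.4) (p. 91) and Theorem 4.2.2 (pp. 91-92); Kesten1963SAW, Section 4] -/
theorem wallDensity_pinch_of_differentiableAt (hy : hexConnectiveConstant ^ 4 < y) (hd : DifferentiableAt ℝ wallRate y) :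
    1 / (2 * pwbMean y) ≤ y * deriv wallRate y / wallRate y ∧
      y * deriv wallRate y / wallRate y ≤ (1 + 1 / pwbMean y) / 4 := by
  obtain ⟨h1, h2⟩ := densities_eq_dp hy hd
  have hl := inv_two_mul_pwbMean_le_wallRightDensity (mu_four_lt_exp_log_dp hy)
  have hu := wallLeftDensity_le_quarter_mul (mu_four_lt_exp_log_dp hy)
  rw [exp_log_dp hy] at hl hu
  exact ⟨h1 ▸ hl, h2 ▸ hu⟩

/-- **★★ DEFICIT PINCH at a point of differentiability: for `y > μ⁴` with `β` differentiable at `y`,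
`(m(y) − 1)/(4 m(y)) ≤ ½ − y β'(y)/β(y) ≤ (m(y) − 1)/(2 m(y))`** — the density deficit `½ − ρ(y)` is comparable, within a
factor two, to the relative renewal excess `(m(y) − 1)/m(y)` of Kesten's prime-wall-bridge law.
[cite: BeatonBousquetMelouDeGierDuminilCopinGuttmann2014, Section 3.1, Proposition 5 (arXiv v5 p. 9) and p. 10;
Hollander2009, Section 7.1, Theorem 7.3 and (7.26); JansevanRensburg2000, Section 3.3, eq. (3.17); MadrasSlade1993, Section 4.2,
(4.2.4) (p. 91) and Theorem 4.2.2 (pp. 91-92); Kesten1963SAW, Section 4] -/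
theorem wallDensity_deficit_pinch_of_differentiableAt (hy : hexConnectiveConstant ^ 4 < y)
    (hd : DifferentiableAt ℝ wallRate y) :
    (pwbMean y - 1) / (4 * pwbMean y) ≤ 1 / 2 - y * deriv wallRate y / wallRate y ∧
      1 / 2 - y * deriv wallRate y / wallRate y ≤ (pwbMean y - 1) / (2 * pwbMean y) := by
  obtain ⟨h1, h2⟩ := densities_eq_dp hy hd
  have hl := le_half_sub_wallLeftDensity (mu_four_lt_exp_log_dp hy)
  have hu := half_sub_wallRightDensity_le (mu_four_lt_exp_log_dp hy)
  rw [exp_log_dp hy] at hl hu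
  exact ⟨h2 ▸ hl, h1 ▸ hu⟩

/-- **`y β'(y) ≤ β(y) (½ − 1/(20 y² + 8))` for `y > μ⁴` with `β` differentiable at `y`** — the explicit sharpening on the regime
`y > μ⁴` of the tree's `mul_deriv_wallRate_le_half` (`y β'(y) ≤ β(y)/2`, all `y > 0`).
[cite: BeatonBousquetMelouDeGierDuminilCopinGuttmann2014, Section 3.1, Proposition 5 (arXiv v5 p. 9: "almost everywhere
differentiable"); JansevanRensburgWhittington2013, Section 3.1, eq. (3.3) (arXiv v4 p. 6); MadrasSlade1993, Section 4.2,
(4.2.4) (p. 91)] -/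
theorem mul_deriv_wallRate_le_half_sub (hy : hexConnectiveConstant ^ 4 < y) (hd : DifferentiableAt ℝ wallRate y) :
    y * deriv wallRate y ≤ wallRate y * (1 / 2 - 1 / (20 * y ^ 2 + 8)) := by
  obtain ⟨h1, -⟩ := densities_eq_dp hy hd
  have hu := wallRightDensity_le_half_sub (mu_four_lt_exp_log_dp hy)
  rw [exp_log_dp hy, h1, div_le_iff₀ (wallRate_pos y)] at hu
  linarith

/-- **`β(y) ≤ 2 m(y) · y β'(y)` for `y > μ⁴` with `β` differentiable at `y`** (product form of the lower density bound).
[cite: BeatonBousquetMelouDeGierDuminilCopinGuttmann2014, Section 3.1, Proposition 5 (arXiv v5 p. 9) and p. 10;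
Hollander2009, Section 7.1, Theorem 7.3; MadrasSlade1993, Section 4.2, Theorem 4.2.2 (pp. 91-92)] -/
theorem wallRate_le_two_mul_pwbMean_mul_deriv (hy : hexConnectiveConstant ^ 4 < y) (hd : DifferentiableAt ℝ wallRate y) :
    wallRate y ≤ 2 * pwbMean y * (y * deriv wallRate y) := by
  have hm : 0 < pwbMean y := pwbMean_pos hy
  have h := (wallDensity_pinch_of_differentiableAt hy hd).1
  rw [div_le_div_iff₀ (by positivity) (wallRate_pos y), one_mul] at h
  linarith

/-- **`0 < β'(y)` for `y > μ⁴` with `β` differentiable at `y`**: the growth rate of zig-zag wall bridges is STRICTLY increasing to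
first order wherever it is differentiable on `y > μ⁴` (pointwise companion of «STRICT-RATE»'s `strictMonoOn_wallRate`).
[cite: BeatonBousquetMelouDeGierDuminilCopinGuttmann2014, Section 3.1 (arXiv v5 p. 10: "is positive for y > y_c");
JansevanRensburg2000, Section 5.4, Theorem 5.55; HammersleyTorrieWhittington1982, Section 2] -/
theorem deriv_wallRate_pos (hy : hexConnectiveConstant ^ 4 < y) (hd : DifferentiableAt ℝ wallRate y) :
    0 < deriv wallRate y := by
  have hy0 : 0 < y := (pow_pos hexConnectiveConstant_pos 4).trans hy
  have hm : 0 < pwbMean y := pwbMean_pos hy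
  have h1 : 0 < 2 * pwbMean y * (y * deriv wallRate y) :=
    (wallRate_pos y).trans_le (wallRate_le_two_mul_pwbMean_mul_deriv hy hd)
  exact pos_of_mul_pos_right (pos_of_mul_pos_right h1 (by positivity)) hy0.le

/-- **★★ ALMOST EVERYWHERE: for almost every `y`, if `y > μ⁴` then `β` is differentiable at `y` and
`1/(2 m(y)) ≤ y β'(y)/β(y) ≤ (1 + 1/m(y))/4`** (tree `ae_differentiableAt_wallRate` + the pointwise pinch).
[cite: BeatonBousquetMelouDeGierDuminilCopinGuttmann2014, Section 3.1, Proposition 5 (arXiv v5 p. 9: "almost everywhere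
differentiable") and p. 10; JansevanRensburgWhittington2013, Section 3.1, eq. (3.3)-(3.4) (arXiv v4 p. 6); MadrasSlade1993,
Section 4.2, (4.2.4) (p. 91) and Theorem 4.2.2 (pp. 91-92)] -/
theorem ae_wallDensity_pinch :
    ∀ᵐ y : ℝ, hexConnectiveConstant ^ 4 < y →
      DifferentiableAt ℝ wallRate y ∧ 1 / (2 * pwbMean y) ≤ y * deriv wallRate y / wallRate y ∧
        y * deriv wallRate y / wallRate y ≤ (1 + 1 / pwbMean y) / 4 := by
  filter_upwards [ae_differentiableAt_wallRate] with y h hy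
  have hd := h ((pow_pos hexConnectiveConstant_pos 4).trans hy)
  exact ⟨hd, wallDensity_pinch_of_differentiableAt hy hd⟩

/-- **ALMOST EVERYWHERE DEFICIT PINCH: for almost every `y > μ⁴`,
`(m(y) − 1)/(4 m(y)) ≤ ½ − y β'(y)/β(y) ≤ (m(y) − 1)/(2 m(y))` and `1/(20 y² + 8) ≤ ½ − y β'(y)/β(y)`.**
[cite: BeatonBousquetMelouDeGierDuminilCopinGuttmann2014, Section 3.1, Proposition 5 (arXiv v5 p. 9) and p. 10;
Hollander2009, Section 7.1, Theorem 7.3 and (7.26); MadrasSlade1993, Section 4.2, (4.2.4) (p. 91) and Theorem 4.2.2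
(pp. 91-92)] -/
theorem ae_wallDensity_deficit_pinch :
    ∀ᵐ y : ℝ, hexConnectiveConstant ^ 4 < y →
      (pwbMean y - 1) / (4 * pwbMean y) ≤ 1 / 2 - y * deriv wallRate y / wallRate y ∧
        1 / 2 - y * deriv wallRate y / wallRate y ≤ (pwbMean y - 1) / (2 * pwbMean y) ∧
          1 / (20 * y ^ 2 + 8) ≤ 1 / 2 - y * deriv wallRate y / wallRate y := by
  filter_upwards [ae_differentiableAt_wallRate] with y h hy
  have hd := h ((pow_pos hexConnectiveConstant_pos 4).trans hy)
  refine ⟨(wallDensity_deficit_pinch_of_differentiableAt hy hd).1, (wallDensity_deficit_pinch_of_differentiableAt hy hd).2, ?_⟩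
  have hu := mul_deriv_wallRate_le_half_sub hy hd
  have hρ : y * deriv wallRate y / wallRate y ≤ 1 / 2 - 1 / (20 * y ^ 2 + 8) := by
    rw [div_le_iff₀ (wallRate_pos y)]
    linarith
  linarith


end Literature.Probability.RandomPlanarGeometry.SAW.HexBW.Wall
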